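import Mathlib
import HarnessLib
import Literature.MathematicalPhysics.StatisticalMechanics.StepOperatorABKM
import Literature.MathematicalPhysics.StatisticalMechanics.RelevantHamiltonianSpace
import Literature.MathematicalPhysics.StatisticalMechanics.RGStepABKM

/-!
# Lipschitz dependence of `(A_k^{(q)})⁻¹` on the shift `γ`: `‖A(γ)⁻¹H − A(γ')⁻¹H‖_{k,0} ≤ a‖H‖_{k+1,0}`
# ([ABKM19] Lemma 10.5 / Ch. 12, hypothesis `ha` of Lemma 12.6)

The inverse `A(γ)⁻¹` of the linear step of [ABKM19] Theorem 6.8 changes only the constant coefficient,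
`a_∅ = a'_∅ − Σ_q γ_q a'_q` (`RelevantHamiltonianStepOperator.stepOpAInv`), so two inverses differ by
`(A(γ)⁻¹ − A(γ')⁻¹)H = −Σ_q (γ_q − γ'_q) a'_q · 1`: its scale-`k` coefficient norm is
`n_k |Σ_q (γ_q − γ'_q) a'_q| ≤ a · ‖H‖_{k+1,0}` as soon as `n_k |γ_q − γ'_q| ≤ a · n_{k+1}(𝔥_{k+1}/R_{k+1})²`
for all `q` — the operator half of hypothesis `ha` (`‖(A^h_k)⁻¹ − (A^{h'}_k)⁻¹‖ ≤ a₀‖h − h'‖`) of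
`RGFlow.exists_isTunedQ_initial_eq` (the kernel half, `|γ(𝒞_{1+q}) − γ(𝒞_{1+q'})| = O(|q−q'|L^{−dk})`,
is `TorusFRDGradCovLipschitz.abs_gradCov_sub_le_of_torusFRD`).

* `stepOpAInv_sub_stepOpAInv_const/_lin/_quad` — the coefficients of the difference;
* **`hamNorm_stepOpAInv_sub_le`** — the abstract bound;
* **`hamNorm_stepOpAInv_sub_abkm_le`** — for the torus weights (`𝔥_k = fieldWt h L d k`, `R_k = L^k`,
  `n_k = L^{dk}`): `L^{dk}|γ_q − γ'_q| ≤ δ` for all `q` gives the constant `a = δ/(4h²)`;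
* `norm_rgA_symm_sub_le` — the same as an inequality of `HamSpace` norms for `rgA L h 𝒞s k` vs
  `rgA L h 𝒞s' k` (`RGStepABKM.rgA`).

Everything is proved; no named fact.

## References
* S. Adams, S. Buchholz, R. Kotecký, S. Müller, arXiv:1910.13564, Lemma 10.5, Ch. 12 (12.50)–(12.56)
  [AdamsBuchholzKoteckyMuller2019].
-/

noncomputable section

namespace Literature.MathematicalPhysics.StatisticalMechanics.GradientRG

open scoped BigOperators
open Finset

variable {𝕜 : Type*} [NormedField 𝕜] [NormedAlgebra ℝ 𝕜] {d : ℕ}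

/-- The constant coefficient of `A(γ)⁻¹H − A(γ')⁻¹H` is `−Σ_q (γ_q − γ'_q) a'_q`.
[cite: AdamsBuchholzKoteckyMuller2019, Lemma 10.5] -/
theorem stepOpAInv_sub_stepOpAInv_const (γ γ' : quadIndex d → ℝ) (H : RelevantHamiltonian 𝕜 d) (u : Unit) :
    (stepOpAInv γ H - stepOpAInv γ' H) (Sum.inl u) =
      -∑ q : quadIndex d, ((γ q - γ' q : ℝ)) • H (Sum.inr (Sum.inr q)) := by
  rw [Pi.sub_apply, stepOpAInv_const, stepOpAInv_const]
  simp only [sub_smul, Finset.sum_sub_distrib]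
  abel

/-- The linear coefficients of `A(γ)⁻¹H − A(γ')⁻¹H` vanish. [cite: AdamsBuchholzKoteckyMuller2019, Lemma 10.5] -/
theorem stepOpAInv_sub_stepOpAInv_lin (γ γ' : quadIndex d → ℝ) (H : RelevantHamiltonian 𝕜 d) (α : linIndex d) :
    (stepOpAInv γ H - stepOpAInv γ' H) (Sum.inr (Sum.inl α)) = 0 := by
  rw [Pi.sub_apply, stepOpAInv_lin, stepOpAInv_lin, sub_self]

/-- The quadratic coefficients of `A(γ)⁻¹H − A(γ')⁻¹H` vanish. [cite: AdamsBuchholzKoteckyMuller2019, Lemma 10.5] -/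
theorem stepOpAInv_sub_stepOpAInv_quad (γ γ' : quadIndex d → ℝ) (H : RelevantHamiltonian 𝕜 d) (q : quadIndex d) :
    (stepOpAInv γ H - stepOpAInv γ' H) (Sum.inr (Sum.inr q)) = 0 := by
  rw [Pi.sub_apply, stepOpAInv_quad, stepOpAInv_quad, sub_self]

/-- **`‖A(γ)⁻¹H − A(γ')⁻¹H‖_{𝔥,R,n} ≤ a · ‖H‖_{𝔥',R',n'}`** whenever `n|γ_q − γ'_q| ≤ a · n'(𝔥'/R')²` for
all `q` (`𝔥', R', a ≥ 0`). [cite: AdamsBuchholzKoteckyMuller2019, Lemma 10.5] -/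
theorem hamNorm_stepOpAInv_sub_le [NormOneClass 𝕜] {𝔥 R 𝔥' R' a : ℝ} {n n' : ℕ} (h𝔥' : 0 ≤ 𝔥')
    (hR' : 0 ≤ R') (ha : 0 ≤ a) {γ γ' : quadIndex d → ℝ}
    (hγ : ∀ q, (n : ℝ) * |γ q - γ' q| ≤ a * (n' * (𝔥' / R') ^ 2)) (H : RelevantHamiltonian 𝕜 d) :
    hamNorm 𝔥 R n (stepOpAInv γ H - stepOpAInv γ' H) ≤ a * hamNorm 𝔥' R' n' H := by
  have hn : (0 : ℝ) ≤ n := Nat.cast_nonneg _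
  have hn' : (0 : ℝ) ≤ n' := Nat.cast_nonneg _
  set cq : quadIndex d → ℝ := fun q => ‖H (Sum.inr (Sum.inr q))‖ with hcq
  have hcq0 : ∀ q, 0 ≤ cq q := fun q => norm_nonneg _
  -- the left-hand side: only the constant coefficient survives
  have hlhs : hamNorm 𝔥 R n (stepOpAInv γ H - stepOpAInv γ' H) =
      (n : ℝ) * ‖∑ q : quadIndex d, ((γ q - γ' q : ℝ)) • H (Sum.inr (Sum.inr q))‖ := by
    unfold hamNorm
    simp only [stepOpAInv_sub_stepOpAInv_const, stepOpAInv_sub_stepOpAInv_lin,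
      stepOpAInv_sub_stepOpAInv_quad, norm_zero, mul_zero, Finset.sum_const_zero, add_zero, norm_neg]
  rw [hlhs]
  -- bound the sum
  have hsum : ‖∑ q : quadIndex d, ((γ q - γ' q : ℝ)) • H (Sum.inr (Sum.inr q))‖ ≤
      ∑ q, |γ q - γ' q| * cq q := by
    refine (norm_sum_le _ _).trans (Finset.sum_le_sum fun q _ => ?_)
    rw [norm_smul, Real.norm_eq_abs]
  have h1 : (n : ℝ) * ‖∑ q : quadIndex d, ((γ q - γ' q : ℝ)) • H (Sum.inr (Sum.inr q))‖ ≤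
      a * (n' * ∑ q, (𝔥' / R') ^ 2 * cq q) := by
    calc (n : ℝ) * ‖∑ q : quadIndex d, ((γ q - γ' q : ℝ)) • H (Sum.inr (Sum.inr q))‖
        ≤ n * ∑ q, |γ q - γ' q| * cq q := mul_le_mul_of_nonneg_left hsum hn
      _ = ∑ q, (n * |γ q - γ' q|) * cq q := by rw [Finset.mul_sum]; simp only [mul_assoc]
      _ ≤ ∑ q, (a * (n' * (𝔥' / R') ^ 2)) * cq q :=
          Finset.sum_le_sum fun q _ => mul_le_mul_of_nonneg_right (hγ q) (hcq0 q)
      _ = a * (n' * ∑ q, (𝔥' / R') ^ 2 * cq q) := by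
          rw [Finset.mul_sum, Finset.mul_sum]
          refine Finset.sum_congr rfl fun q _ => ?_; ring
  refine h1.trans (mul_le_mul_of_nonneg_left ?_ ha)
  -- `n' Σ (𝔥'/R')² cq ≤ hamNorm 𝔥' R' n' H`
  unfold hamNorm
  have hc0 : 0 ≤ ‖H (Sum.inl ())‖ := norm_nonneg _
  have hlin : 0 ≤ ∑ α : linIndex d, 𝔥' * (R' ^ (∑ i, (α : Fin d → ℕ) i))⁻¹ * ‖H (Sum.inr (Sum.inl α))‖ :=
    Finset.sum_nonneg fun α _ => mul_nonneg (mul_nonneg h𝔥' (inv_nonneg.2 (pow_nonneg hR' _))) (norm_nonneg _)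
  have : ∑ q, (𝔥' / R') ^ 2 * cq q ≤ ‖H (Sum.inl ())‖ +
      ∑ α : linIndex d, 𝔥' * (R' ^ (∑ i, (α : Fin d → ℕ) i))⁻¹ * ‖H (Sum.inr (Sum.inl α))‖ +
      ∑ q : quadIndex d, (𝔥' / R') ^ 2 * ‖H (Sum.inr (Sum.inr q))‖ := by
    simp only [hcq]; linarith
  exact mul_le_mul_of_nonneg_left this hn'

/-- **The torus weights**: for `𝔥_k = fieldWt h L d k`, `R_k = L^k`, `n_k = L^{dk}` (`d ≥ 2`, `L ≥ 1`,
`h > 0`), `L^{dk}|γ_q − γ'_q| ≤ δ` for all `q` (`δ > 0`) gives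
`‖A(γ)⁻¹H − A(γ')⁻¹H‖_{k,0} ≤ (δ/(4h²)) · ‖H‖_{k+1,0}`. [cite: AdamsBuchholzKoteckyMuller2019, Lemma 10.5] -/
theorem hamNorm_stepOpAInv_sub_abkm_le [NormOneClass 𝕜] {L : ℕ} {h δ : ℝ} (hd : 2 ≤ d) (hL : 1 ≤ L)
    (hh : 0 < h) (hδ : 0 < δ) (k : ℕ) {γ γ' : quadIndex d → ℝ}
    (hγ : ∀ q, ((L ^ (d * k) : ℕ) : ℝ) * |γ q - γ' q| ≤ δ) (H : RelevantHamiltonian 𝕜 d) :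
    hamNorm (fieldWt h L d k) ((L : ℝ) ^ k) (L ^ (d * k)) (stepOpAInv γ H - stepOpAInv γ' H) ≤
      (δ / (4 * h ^ 2)) * hamNorm (fieldWt h L d (k + 1)) ((L : ℝ) ^ (k + 1)) (L ^ (d * (k + 1))) H := by
  have hL0 : (0 : ℝ) < L := by exact_mod_cast (show 0 < L by omega)
  have hh2 : 0 < h ^ 2 := by positivity
  refine hamNorm_stepOpAInv_sub_le (fieldWt_pos hh hL0 d (k + 1)).le (by positivity) (by positivity)
    (fun q => ?_) H
  -- rescale: `g = (γ_q − γ'_q) h²/δ` has `L^{dk}|g| ≤ h²`, so `abkm_weight_shift` applies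
  have hg : ((L ^ (d * k) : ℕ) : ℝ) * |(γ q - γ' q) * (h ^ 2 / δ)| ≤ h ^ 2 := by
    rw [abs_mul, abs_of_pos (div_pos hh2 hδ), ← mul_assoc]
    calc ((L ^ (d * k) : ℕ) : ℝ) * |γ q - γ' q| * (h ^ 2 / δ) ≤ δ * (h ^ 2 / δ) :=
          mul_le_mul_of_nonneg_right (hγ q) (div_pos hh2 hδ).le
      _ = h ^ 2 := by field_simp
  have hs := abkm_weight_shift (h := h) hd hL k hg
  rw [abs_mul, abs_of_pos (div_pos hh2 hδ), ← mul_assoc] at hs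
  -- divide by `h²/δ`
  have hpos : 0 < h ^ 2 / δ := div_pos hh2 hδ
  have := (le_div_iff₀ hpos).2 hs
  refine this.trans (le_of_eq ?_)
  field_simp

/-- **Hypothesis `ha` of Lemma 12.6 for the torus steps**: for two step-kernel families `𝒞s, 𝒞s'` with
`L^{dk}|γ_q(𝒞s_{k+1}) − γ_q(𝒞s'_{k+1})| ≤ δ` (`δ > 0`), the inverses of `rgA L h 𝒞s k` and
`rgA L h 𝒞s' k` differ by at most `δ/(4h²)` in operator norm between the `HamSpace`s of scales `k+1`
and `k`. [cite: AdamsBuchholzKoteckyMuller2019, Lemma 12.6 (12.51)] -/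
theorem norm_rgA_symm_sub_le {M : ℕ} [NeZero M] {L : ℕ} {h δ : ℝ} [Fact (0 < h)] [Fact (0 < L)]
    {𝒞s 𝒞s' : ℕ → (Fin d → ZMod M) → ℝ} (hd : 2 ≤ d) (hδ : 0 < δ) (k : ℕ)
    (hγ : ∀ q, ((L ^ (d * k) : ℕ) : ℝ) * |gradCov (𝒞s (k + 1)) q - gradCov (𝒞s' (k + 1)) q| ≤ δ)
    (w : HamSpace ℂ d (fieldWt h (L : ℝ) d (k + 1)) ((L : ℝ) ^ (k + 1)) (L ^ (d * (k + 1)))) :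
    ‖(rgA L h 𝒞s k).symm w - (rgA L h 𝒞s' k).symm w‖ ≤ δ / (4 * h ^ 2) * ‖w‖ := by
  have hh : 0 < h := Fact.out
  have hL : 0 < L := Fact.out
  rw [HamSpace.norm_def, HamSpace.norm_def, map_sub]
  unfold rgA
  rw [toHam_stepOpAEquiv_symm, toHam_stepOpAEquiv_symm]
  exact hamNorm_stepOpAInv_sub_abkm_le hd hL hh hδ k hγ _

end Literature.MathematicalPhysics.StatisticalMechanics.GradientRG

end
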